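import Summits.QuantumFields.YangMills.Theorems.UnitScaleTiltProp8FlatPortRowSum
import Summits.QuantumFields.YangMills.Theorems.UnitScaleTiltProp8FlatPortDistanceL0
import Summits.QuantumFields.YangMills.Theorems.BalabanUVNodesK0FlatCubeOpsTextP
import Literature.MathematicalPhysics.QuantumFieldTheory.Balaban1983to89.B6Cor28KLevelV1L0
import Literature.MathematicalPhysics.QuantumFieldTheory.Balaban1983to89.B11B3
import HarnessLib

/-!
# K0⁷ `stub_prop8StepCoP13` (stmt-QuantumFields-20541), sub-target S5, S5 ROAD item (b) — the d-generic port, file P6 (twin of `UnitScaleTiltProp8FlatPortRowSumL0`):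
# **[Balaban1985Variational] (162) — THE ROW SUM `K0FlatCubeOpsTextP.RowSum162` AT EVERY CHARTED FAMILY OF THE TORI `PV d ℓ m K`, OVER `dBI := d_T + 3`, k-UNIFORMLY, WITH
# `B₃ = 2(d+1)·L·(8∕(e·δ₀) + 4)·K261 N₀ (d+1) L 1 (δ₀∕4)`** (from lit-balaban's Lemma 2.1 on the torus, (2.61) at rate `δ₀∕4`, and the level absorption (2.60))

Cell `pub-ymgap`, width seat `pub-ymgap-k0-s1-w3` gen 2 (D-0149; START LIST v7 §k0-s1 «S5 ROAD LOCATED … UNOWNED ×3», item (b) = the d-GENERIC PORT re-run of the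
ym3-torus bridge `UnitScaleTiltProp8FlatPort*L0`, plan g80 WORDS-1b l.25728).  `--kind proof --supports stmt-QuantumFields-20541 --as helper`; count-neutral; def-free.
METHOD: the UST file is re-typed with the carrier `PV 2 ℓ m K ↦ PV d ℓ m K hd hL` (dimension `2 + 1 ↦ d + 1`, directions `Fin (d + 1)`), the P2 letters read in their
carrier-generic form `K0FlatCubeOpsTextP.*` at `(P, k) := (PV d ℓ m K hd hL, K − n)` (the `T3Family` binder and `hm : 1 ≤ m` disappear); proofs VERBATIM after the
substitution; every `D`-free ∕ carrier-free lemma of the UST files is consumed BY NAME (imports), nothing of theirs restated.  lit-balaban's k-level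
[Balaban1984PropagatorsII] rows (`…KLevelV1L0`, generic in `d`) are the content, consumed by name.

WHAT IS PROVED (sorry-free; axioms standard; no definition): **`rowSum162_domT`** — `RowSum162 (PV d ℓ m K) (K − n) (domT hN D hk) (d_T + 3) w δ₀ B₃` under the Lemma-2.1 budget
`N₀` (`N₀ + 1 ≤ R·L·M_h`, the (2.59)-shape threshold `e^{−δ₀∕4}·L^{2(d+1)∕N₀} < 1`) and the absorption smallness `L·e^{−(δ₀∕8)(R·L·M_h − 1)} ≤ 1`.
THE PRINT (p. 303): *«Let us take B₃ = 72d³L³B₀ sup_{y₁} Σ_{y₂∈ℭ_k} e^{−½δ₀d(y₁,y₂)}(d(y₁,y₂) + 1)(L^{j₂}η)^{−1}. (162) It follows from the inequalities (2.47)–(2.51) of [3] that B₃ depends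
on d and L only.»*
HONEST FRAMING: count-neutral helper; nothing of [Balaban1985Variational] Sect. F itself is asserted; K0⁷ OPEN; N07 NOT discharged (5∕27 unmoved); one finite 𝕋⁴ programme
at fixed ε — R4 closes the conditional finite-𝕋⁴ rung `BalabanLadder.UV` only; the YM mass gap (Clay) is NOT proved by any of this; nothing continuum ∕ ℝ⁴ ∕ OS.

References: T. Bałaban, CMP **102** (1985) 277–309 [Balaban1985Variational] (162)–(163) p.303; CMP **96** (1984) 223–250 [Balaban1984PropagatorsII] Lemma 2.1 (2.59)–(2.61) pp.233–234.
-/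

set_option autoImplicit false

noncomputable section

open scoped BigOperators

namespace Summit.QuantumFields.YangMills.Theorems.K0FlatPortRowSumP

open FlatPortRowSum (add_four_mul_exp_neg_le pow_div_pow_le_pow_natAbs)

open Literature.MathematicalPhysics.QuantumFieldTheory.Balaban1983to89
open B6MultiLevelBoxOperator (N0)
open B6MultiLevelTorusOperatorL0 (TDomains)
open B6Geom246MultiLevelBoxL0 (bset)
open B6Geom246MultiLevelTorusL0 (geomT bondT lemma21_torus)
open B6GlobalChartV1 (PV toBox)
open B6GlobalChartV1L0 (blkV1 domT)
open B6Ineq2142KLevelV1L0 (lvl lvl_le β beta_level)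
open B6Ineq281MultiLevelBoxL0 (lgap)
open B6Ineq261LevelGap (K261 K261_nonneg)
open B6Prop26KLevelAssemblyV1L0 (distT_nonneg)
open B6Cor28KLevelV1L0 (powL_lgap_le sum_comp_beta_le)
open B6SectAOperatorsV1 (BondIdx)
open B11Eq115Space (levOf)
open Summit.QuantumFields.YangMills.Theorems.K0FlatCubeOpsTextP (IsLevWeight RowSum162)
open FlatPortDistanceL0 (levOf_domT blkV1_level)

/-! ## §1 Two pieces of arithmetic -/

/-! ## §2 The row sum at a charted family -/

section Carrier

variable (d ℓ : ℕ) (hd : 1 ≤ d + 1) (hL : Odd (ℓ + 1) ∧ 1 < ℓ + 1) (m : ℕ) (n K : ℕ)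
variable {Mh R : ℕ} {P' : Fin (d + 1) → ℕ}
variable (hN : ∀ μ, N0 ℓ Mh (K - n) P' μ = (PV d ℓ m K hd hL).sitesPerDir 0) (D : TDomains d ℓ Mh (K - n) P' R) (hk : K - n ≤ m + K)

/-- **(162) AT THE CHARTED FAMILY, OVER `dBI := d_T + 3`, k-UNIFORMLY** — `RowSum162 F n K (domT hN D hk) (d_T + 3) w δ₀ B₃` with
`B₃ = 2(d+1)·L·(8/(e·δ₀) + 4)·K261 N₀ (d+1) L 1 (δ₀/4)`, under the two «R M large» thresholds. [cite: Balaban1985Variational, (162)-(163) p.303; Balaban1984PropagatorsII, Lemma 2.1 (2.60)-(2.61) p.234] -/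
theorem rowSum162_domT (hMh : 1 ≤ Mh) (hP : ∀ μ, 1 ≤ P' μ) {δ₀ : ℝ} (hδ₀ : 0 < δ₀) {N₀ : ℕ} (hN₀ : 0 < N₀)
    (hRM : N₀ + 1 ≤ R * ((ℓ + 1) * Mh)) (hθ : Real.exp (-(1 / 4 * δ₀)) * ((ℓ : ℝ) + 1) ^ ((2 * (d + 1 : ℕ) : ℝ) / N₀) < 1)
    (hsmall : ((ℓ : ℝ) + 1) ^ 1 * Real.exp (-(δ₀ / 8 * ((R : ℝ) * (((ℓ : ℝ) + 1) * Mh) - 1))) ≤ 1)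
    (w : ℕ → PBond (PV d ℓ m K hd hL) 0 → ℝ) (hw : IsLevWeight (PV d ℓ m K hd hL) (K - n) (B6GlobalChartV1L0.domT (hd := hd) hN D hk) w) :
    RowSum162 (PV d ℓ m K hd hL) (K - n) (domT (hd := hd) hN D hk)
      (fun b c => ((bondT D).dist (blkV1 hN D b) (β hN D hk c) : ℝ) + 3) w δ₀
      (2 * ((d : ℝ) + 1) * ((ℓ : ℝ) + 1) * (1 / (Real.exp 1 * (δ₀ / 8)) + 4) * K261 N₀ (d + 1) ((ℓ : ℝ) + 1) 1 (1 / 4 * δ₀)) := by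
  intro b
  -- notation
  set Lr : ℝ := (ℓ : ℝ) + 1 with hLr
  have hL1 : (1 : ℝ) ≤ Lr := by rw [hLr]; linarith [(Nat.cast_nonneg ℓ : (0 : ℝ) ≤ ℓ)]
  have hL0 : (0 : ℝ) < Lr := lt_of_lt_of_le zero_lt_one hL1
  have hcast : (((ℓ + 1 : ℕ) : ℝ)) = Lr := by rw [hLr]; push_cast; ring
  set y := blkV1 hN D b with hy
  set C8 : ℝ := 1 / (Real.exp 1 * (δ₀ / 8)) + 4 with hC8
  have hC80 : 0 ≤ C8 := by have := Real.exp_pos 1; rw [hC8]; positivity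
  set c1 : ℝ := K261 N₀ (d + 1) Lr 1 (1 / 4 * δ₀) with hc1
  have hc10 : 0 ≤ c1 := K261_nonneg hL0.le zero_le_one
  -- (2.61) at rate `δ₀/4` and the level absorption (2.60)
  obtain ⟨-, h261, -, -⟩ := lemma21_torus (D := D) hMh hP hN₀ hRM hδ₀.le (by norm_num : (0 : ℝ) ≤ 1 / 4) (by norm_num : (1 : ℝ) / 4 ≤ 1) hθ
  have hRM1 : 1 ≤ R * ((ℓ + 1) * Mh) := le_trans (by omega) hRM
  have habs := powL_lgap_le D hMh hP hRM1 1 (by positivity : (0 : ℝ) ≤ δ₀ / 8) hsmall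
  -- the weight `w 1 b = L^{j(b)}·L^{−(K−n)}`
  have hFL : ((((PV d ℓ m K hd hL).L : ℕ) : ℝ)) = Lr := hcast
  have hw1 : w 1 b = Lr ^ D.lev (toBox hN b.src : Fin (d + 1) → ℤ) * (Lr⁻¹) ^ (K - n) := by
    have hlev : levOf (fun j => {x : Site ((PV d ℓ m K hd hL)) 0 | (domT (hd := hd) hN D hk).InOm j x}) (K - n) b.src =
        D.lev (toBox hN b.src : Fin (d + 1) → ℤ) := levOf_domT (hd := hd) hN D hk b.src
    rw [hw 1 b, pow_one, hFL]
    -- the implicit `Params` of the level set is `F.P K` (defeq, not syntactically, `PV …`): close by `congrArg` at default transparency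
    exact congrArg (fun e : ℕ => Lr ^ e * (Lr⁻¹) ^ (K - n)) hlev
  -- termwise bound: `w₁(b)·e^{−½δ₀(d+3)}(d+4)L^{(K−n)−j(c)} ≤ L·C₈·e^{−(δ₀/4)d}`
  have hterm : ∀ c : BondIdx (domT (hd := hd) hN D hk),
      w 1 b * (Real.exp (-(δ₀ / 2 * (((bondT D).dist y (β hN D hk c) : ℝ) + 3))) * ((((bondT D).dist y (β hN D hk c) : ℝ) + 3) + 1) *
        ((((PV d ℓ m K hd hL).L : ℕ) : ℝ) ^ ((K - n) - (c.1.1 : ℕ)))) ≤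
      Lr * C8 * Real.exp (-(1 / 4 * δ₀ * (geomT D).dist y (β hN D hk c))) := by
    intro c
    set t : ℝ := ((bondT D).dist y (β hN D hk c) : ℝ) with ht
    have ht0 : 0 ≤ t := Nat.cast_nonneg _
    have hdist : (geomT D).dist y (β hN D hk c) = t := rfl
    have hjc : (c.1.1 : ℕ) ≤ K - n := lvl_le hN D hk c
    -- the level factor `L^{j(b)}·L^{−k}·L^{k−j(c)} = L^{j(b)}/L^{j(c)} ≤ L^{|j(b)−j(c)|} ≤ L·e^{(δ₀/8)t}`
    have hLfac : w 1 b * ((((PV d ℓ m K hd hL).L : ℕ) : ℝ) ^ ((K - n) - (c.1.1 : ℕ))) ≤ Lr * Real.exp (δ₀ / 8 * t) := by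
      rw [hw1, hFL]
      have e2 : Lr ^ D.lev (toBox hN b.src : Fin (d + 1) → ℤ) * (Lr⁻¹) ^ (K - n) * Lr ^ ((K - n) - (c.1.1 : ℕ)) =
          Lr ^ D.lev (toBox hN b.src : Fin (d + 1) → ℤ) / Lr ^ (c.1.1 : ℕ) := by
        rw [inv_pow, eq_div_iff (pow_ne_zero _ hL0.ne'), mul_assoc, mul_assoc, ← pow_add, Nat.sub_add_cancel hjc, inv_mul_cancel₀ (pow_ne_zero _ hL0.ne'), mul_one]
      rw [e2]
      have hgap : Lr ^ D.lev (toBox hN b.src : Fin (d + 1) → ℤ) / Lr ^ (c.1.1 : ℕ) ≤ Lr ^ lgap D.toDomains y (β hN D hk c) := by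
        have := pow_div_pow_le_pow_natAbs hL1 (D.lev (toBox hN b.src : Fin (d + 1) → ℤ)) (c.1.1 : ℕ)
        have hlg : lgap D.toDomains y (β hN D hk c) = Int.natAbs ((D.lev (toBox hN b.src : Fin (d + 1) → ℤ) : ℤ) - (c.1.1 : ℕ)) := by
          unfold lgap
          rw [hy, blkV1_level, beta_level hN D hk c]
        rw [hlg]; exact this
      have habs' := habs y (β hN D hk c)
      rw [pow_one] at habs'
      rw [hdist] at habs'
      exact hgap.trans habs'
    -- the exponential factor
    have hexp3 : Real.exp (-(δ₀ / 2 * (t + 3))) ≤ Real.exp (-(δ₀ / 2 * t)) := Real.exp_le_exp.2 (by nlinarith)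
    have hsplit : Real.exp (-(δ₀ / 2 * t)) = Real.exp (-(δ₀ / 8 * t)) * Real.exp (-(δ₀ / 8 * t)) * Real.exp (-(1 / 4 * δ₀ * t)) := by
      rw [← Real.exp_add, ← Real.exp_add]; congr 1; ring
    have hpoly : (t + 3 + 1) * Real.exp (-(δ₀ / 8 * t)) ≤ C8 := by
      have := add_four_mul_exp_neg_le (s := δ₀ / 8) (by positivity) ht0
      rw [hC8]; convert this using 2; ring
    have hcancel : Real.exp (δ₀ / 8 * t) * Real.exp (-(δ₀ / 8 * t)) = 1 := by rw [← Real.exp_add, add_neg_cancel, Real.exp_zero]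
    -- assemble
    have hA : 0 ≤ Real.exp (-(δ₀ / 2 * (t + 3))) * (t + 3 + 1) := by positivity
    calc w 1 b * (Real.exp (-(δ₀ / 2 * (t + 3))) * (t + 3 + 1) * ((((PV d ℓ m K hd hL).L : ℕ) : ℝ) ^ ((K - n) - (c.1.1 : ℕ))))
        = (w 1 b * ((((PV d ℓ m K hd hL).L : ℕ) : ℝ) ^ ((K - n) - (c.1.1 : ℕ)))) * (Real.exp (-(δ₀ / 2 * (t + 3))) * (t + 3 + 1)) := by ring
      _ ≤ (Lr * Real.exp (δ₀ / 8 * t)) * (Real.exp (-(δ₀ / 2 * t)) * (t + 3 + 1)) := by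
          refine mul_le_mul hLfac (mul_le_mul_of_nonneg_right hexp3 (by linarith)) hA (by positivity)
      _ = Lr * ((t + 3 + 1) * Real.exp (-(δ₀ / 8 * t))) * (Real.exp (δ₀ / 8 * t) * Real.exp (-(δ₀ / 8 * t))) * Real.exp (-(1 / 4 * δ₀ * t)) := by
          rw [hsplit]; ring
      _ ≤ Lr * C8 * 1 * Real.exp (-(1 / 4 * δ₀ * t)) := by
          rw [hcancel]
          exact mul_le_mul_of_nonneg_right (mul_le_mul_of_nonneg_right (mul_le_mul_of_nonneg_left hpoly hL0.le) zero_le_one) (Real.exp_pos _).le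
      _ = Lr * C8 * Real.exp (-(1 / 4 * δ₀ * (geomT D).dist y (β hN D hk c))) := by rw [mul_one, hdist]
  -- sum over the index bonds: carrier blocks (fibres ≤ 2D = 6) and (2.61)
  have hsum := sum_comp_beta_le hN D hk (g := fun y' => Lr * C8 * Real.exp (-(1 / 4 * δ₀ * (geomT D).dist y y'))) (fun y' => by positivity)
  have h261y := h261 y
  calc w 1 b * ∑ c, Real.exp (-(δ₀ / 2 * (((bondT D).dist (blkV1 hN D b) (β hN D hk c) : ℝ) + 3))) *
          ((((bondT D).dist (blkV1 hN D b) (β hN D hk c) : ℝ) + 3) + 1) * ((((PV d ℓ m K hd hL).L : ℕ) : ℝ)) ^ ((K - n) - (c.1.1 : ℕ))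
      = ∑ c, w 1 b * (Real.exp (-(δ₀ / 2 * (((bondT D).dist y (β hN D hk c) : ℝ) + 3))) * ((((bondT D).dist y (β hN D hk c) : ℝ) + 3) + 1) *
          ((((PV d ℓ m K hd hL).L : ℕ) : ℝ) ^ ((K - n) - (c.1.1 : ℕ)))) := by rw [Finset.mul_sum]
    _ ≤ ∑ c, Lr * C8 * Real.exp (-(1 / 4 * δ₀ * (geomT D).dist y (β hN D hk c))) := Finset.sum_le_sum fun c _ => hterm c
    _ ≤ 2 * ((d : ℝ) + 1) * ∑ y', Lr * C8 * Real.exp (-(1 / 4 * δ₀ * (geomT D).dist y y')) := hsum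
    _ = 2 * ((d : ℝ) + 1) * (Lr * C8) * ∑ y', Real.exp (-(1 / 4 * δ₀ * (geomT D).dist y y')) := by
        conv_lhs => rw [← Finset.mul_sum]
        ring
    _ ≤ 2 * ((d : ℝ) + 1) * (Lr * C8) * c1 := mul_le_mul_of_nonneg_left h261y (by positivity)
    _ = 2 * ((d : ℝ) + 1) * Lr * C8 * c1 := by ring

end Carrier

end Summit.QuantumFields.YangMills.Theorems.K0FlatPortRowSumP

end
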